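import Summits.ValiantsHypothesis.ValiantsHypothesis.Theses.KPlusLogSqLawOctave
import Summits.ValiantsHypothesis.ValiantsHypothesis.Theorems.KPlusLogSqLawOctaveExact
import Summits.ValiantsHypothesis.ValiantsHypothesis.Theorems.KPlusLogSqLawOctaveDefs
import Summits.ValiantsHypothesis.ValiantsHypothesis.Theorems.LacunarySymmetroidMatrixDescartesCensusFormatMonotone
import Summits.ValiantsHypothesis.ValiantsHypothesis.Theorems.KPlusLogSqLawTropicalBRegimeCollapse
import Summits.ValiantsHypothesis.ValiantsHypothesis.Theorems.LacunarySymmetroidMatrixDescartesCensusTropicalKLaw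
import Summits.ValiantsHypothesis.ValiantsHypothesis.Theorems.KPlusLogSqLawTropicalBPolyTowers
import Summits.ValiantsHypothesis.ValiantsHypothesis.Theorems.KPlusLogSqLawWeakLiftingWindow

/-!
# `KPlusLogSqLawOctave` — FAT LOCATION of the octave route: regime collapse of the octave lifting crux Ω-W modulo `TropicalB`,
# size/class padding and diagonal localisation of Ω-B; the route is a FAT-REGIME pair (support, sorry-free)

HONEST FRAMING.  Crux `OctaveWeakLifting` (Ω-W, stmt-ValiantsHypothesis-24457) and its sibling `TropicalB` (stmt-19771) of the route
`KPlusLogSqLawOctave`.  Sorry-free; the regime statements `OctaveFatLifting`, `BoundedAspectOctaveLifting` are DEFINED and used only as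
hypotheses / conclusions of implications — nothing is asserted about them, Ω-W, `TropicalB`, Ω-B, `MatrixDescartes` or VP ≠ VNP.

CONTENT.
* §1 `SignedRow m K n` — verbatim the hypothesis of Ω-W (= `TropRootLawAt`, `Iff.rfl`); Ω-W and `TropicalB` unfolded through it.
* §2 `OctaveFatLifting` (Ω-W restricted to FAT formats `⌊log₂m⌋² ≤ K`, budget `2^(C·K)·(n+1)`) and the bounded-aspect rung
  `BoundedAspectOctaveLifting` (one `C` for every aspect bound `m ≤ A·K`, eventually in `K`).
* §3 format monotonicity of the octave row: class padding `octaveRootLawAt_of_le_classes` (absent slope classes), SIZE padding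
  `octaveRootLawAt_of_le_size` (identity padding on every class, via the tree's `Census.det_pencil_padOne`; the factor `(∑ₗX^{dₗ})^{m'−m}`
  only adds roots: `octaveCount_le_of_mul`), the empty format `octaveRootLawAt_zero_classes`. [folklore]
* §4 **`TropicalB → OctaveFatLifting → OctaveWeakLifting`** (`OctaveWeakLifting_of`, `C = C_F + 2C_T + 1`): on a thin format
  `K < L²` pad the classes up to `K' = L²` (fat, square), where `TropicalB` bounds the signed row by `2^(2C_T L²)` and the fat law applies;
  §5 the converse and **`TropicalB → (OctaveFatLifting ↔ OctaveWeakLifting ↔ Ω-B)`** (`…_iff_octaveKLaw_of_tropicalB`, → via the landed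
  glue `octaveKLaw_of_tropicalB_of_octaveWeakLifting`) — modulo its sibling crux the octave «lifting» crux is the hypothesis-free COUNTING law
  Ω-B and its thin regime is dead weight (critic verdict #13, val-idea-crit-3 g2, 2026-08-28: «must not be advertised as a weaker crux»);
  the rung is a consequence of the crux (`boundedAspectOctaveLifting_of_octaveWeakLifting`, kill path `not_octaveWeakLifting_of_…`).
* §6 calibration: at each FIXED aspect `2^c` the rung holds by Descartes alone (`realRootLawAt_fatCone`) with `C_c = 2(2^c+1)` — the rung's
  content is the UNIFORMITY of `C` in the aspect (octave twin of the tropical `BoundedAspectRate`).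
* §7 **`octaveKLaw_iff_fatPair` : Ω-B ↔ TB-fat ∧ Ω-W-fat** (with `OctaveExact.octaveKLaw_iff` and `fatStub_iff_tropicalB`): the whole octave
  route is equivalent to two fat-regime statements with linear-in-`K` exponents; **`octaveKLaw_iff_diagonal`**: Ω-B ↔ its restriction to the
  single format sequence `(2^s, s²)`, budget `2^(C·s²)` (octave twin of `kPlusLogSqLaw_iff_diagonal`); the same for the NAMED law
  `Octave.OctaveKLaw` of `…OctaveDefs` (`octaveKLaw_iff_glue : … := Iff.rfl`).
[folklore] bookkeeping over tree lemmas; the laws are cell conjectures (no citation exists).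
-/

set_option linter.dupNamespace false
set_option autoImplicit false

namespace Summit.ValiantsHypothesis.ValiantsHypothesis.Theorems.KPlusLogSqLaw.OctaveFatLocation

open Summit.ValiantsHypothesis.ValiantsHypothesis.Theorems.LacunarySymmetroidMatrixDescartes.TropicalCensus (TropRootLawAt)
open Summit.ValiantsHypothesis.ValiantsHypothesis.Theses.KPlusLogSqLawOctave (TropicalB OctaveWeakLifting)
open Summit.ValiantsHypothesis.ValiantsHypothesis.Theorems.KPlusLogSqLaw.OctaveGlue
  (octaveCount OctaveRootLawAt octaveRootLawAt_mono octaveCount_le_card octaveKLaw_of_tropicalB_of_octaveWeakLifting)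
open Summit.ValiantsHypothesis.ValiantsHypothesis.Theorems.LacunarySymmetroidMatrixDescartes (Census.det_pencil_padOne Census.isSymm_padOne Census.sum_X_pow_ne_zero)
open Finset
open Summit.ValiantsHypothesis.ValiantsHypothesis.Theorems.LacunarySymmetroidMatrixDescartes (RealRootLawAt)
open Summit.ValiantsHypothesis.ValiantsHypothesis.Theorems.KPlusLogSqLaw (realRootLawAt_fatCone)
open Summit.ValiantsHypothesis.ValiantsHypothesis.Theorems.KPlusLogSqLaw (PolyTowers.sq_log_succ_le_self)
open Polynomial

/-! ## 1. Currency (verbatim the crux's hypothesis) -/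

/-- the SIGNED tropical row of format `(m, K)` is `≤ n` — verbatim the hypothesis of the route decl `OctaveWeakLifting`. -/
def SignedRow (m K n : ℕ) : Prop :=
  ∀ (d : Fin K → ℕ) (v ε : Fin m → Fin m → Fin K → ℤ) (n' : ℕ) (θ : Fin (n' + 1) → ℤ)
    (p : Fin (n' + 1) → Equiv.Perm (Fin m) × (Fin m → Fin K)),
    (∀ i j l, (ε i j l).natAbs ≤ 1) → StrictMono θ →
    (∀ k, Summit.ValiantsHypothesis.ValiantsHypothesis.Theorems.MatrixDescartes.Negative.IsDominant d v ε (θ k) (p k)) →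
    (∀ k : Fin n', Summit.ValiantsHypothesis.ValiantsHypothesis.Theorems.MatrixDescartes.Negative.termSign ε (p k.castSucc) *
      Summit.ValiantsHypothesis.ValiantsHypothesis.Theorems.MatrixDescartes.Negative.termSign ε (p k.succ) < 0) → n' ≤ n

/-- the crux, unfolded through `SignedRow` (δ). -/
theorem octaveWeakLifting_iff : OctaveWeakLifting ↔
    ∃ C : ℕ, ∀ m K n : ℕ, SignedRow m K n → OctaveRootLawAt m K (2 ^ (C * (K + Nat.log 2 m ^ 2)) * (n + 1)) := Iff.rfl

/-- `SignedRow m K n` is the tree's `TropRootLawAt m K n` (δ). -/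
theorem signedRow_iff_tropRootLawAt (m K n : ℕ) : SignedRow m K n ↔ TropRootLawAt m K n := Iff.rfl

/-- the sibling crux, unfolded (δ). -/
theorem tropicalB_iff : TropicalB ↔ ∃ C : ℕ, ∀ m K : ℕ, SignedRow m K (2 ^ (C * (K + Nat.log 2 m ^ 2))) := by
  constructor
  · rintro ⟨C, hC⟩; exact ⟨C, fun m K d v ε n' θ p hε hθ hdom halt => hC m K d v ε n' θ p hε hθ hdom halt⟩
  · rintro ⟨C, hC⟩; exact ⟨C, fun m K d v ε n' θ p hε hθ hdom halt => hC m K d v ε n' θ p hε hθ hdom halt⟩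

/-! ## 2. The two regime statements (open; NOT claimed — they appear only as hypotheses) -/

/-- **TRANSFER — the FAT octave lifting law**: Ω-W on the fat regime `⌊log₂ m⌋² ≤ K`, budget `2^(C·K)·(n+1)`. -/
def OctaveFatLifting : Prop :=
  ∃ C : ℕ, ∀ m K n : ℕ, Nat.log 2 m ^ 2 ≤ K → SignedRow m K n → OctaveRootLawAt m K (2 ^ (C * K) * (n + 1))

/-- **RUNG (lens `wuc`) — bounded-aspect octave lifting**: one `C` for every aspect bound `A`, eventually in `K`. -/
def BoundedAspectOctaveLifting : Prop :=
  ∃ C : ℕ, ∀ A : ℕ, ∃ K₀ : ℕ, ∀ m K n : ℕ, K₀ ≤ K → m ≤ A * K → SignedRow m K n →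
    OctaveRootLawAt m K (2 ^ (C * K) * (n + 1))

/-! ## 3. Class padding for the octave row -/

/-- appending ABSENT slope classes (zero coefficient matrices) does not change the pencil: the octave row is antitone in `K`. [folklore] -/
theorem octaveRootLawAt_of_le_classes {m K K' B : ℕ} (hK : K ≤ K') (h : OctaveRootLawAt m K' B) : OctaveRootLawAt m K B := by
  obtain ⟨t, rfl⟩ := Nat.exists_eq_add_of_le hK
  intro d S hS
  let d' : Fin (K + t) → ℕ := Fin.append d (fun _ => 0)
  let S' : Fin (K + t) → Matrix (Fin m) (Fin m) ℝ := Fin.append S (fun _ => 0)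
  have hS' : ∀ l, (S' l).IsSymm := by
    intro l
    refine Fin.addCases (motive := fun l => (S' l).IsSymm) (fun i => ?_) (fun j => ?_) l
    · simp only [S', Fin.append_left]; exact hS i
    · simp only [S', Fin.append_right]; exact Matrix.isSymm_zero
  have hsum : (∑ l, ((X : ℝ[X]) ^ d' l) • (S' l).map C) = ∑ l, ((X : ℝ[X]) ^ d l) • (S l).map C := by
    rw [Fin.sum_univ_add]
    have h2 : (∑ j : Fin t, ((X : ℝ[X]) ^ d' (Fin.natAdd K j)) • (S' (Fin.natAdd K j)).map C) = 0 := by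
      refine Finset.sum_eq_zero (fun j _ => ?_)
      simp only [S', Fin.append_right]
      rw [Matrix.map_zero _ (map_zero C), smul_zero]
    rw [h2, add_zero]
    refine Finset.sum_congr rfl (fun i _ => ?_)
    simp only [d', S', Fin.append_left]
  have h1 := h d' S' hS'
  rw [hsum] at h1
  exact h1

/-- the octave statistic of a nonzero multiple can only grow: `octaveCount p ≤ octaveCount (p * q)` for `q ≠ 0`. [folklore] -/
theorem octaveCount_le_of_mul (p q : ℝ[X]) (hq : q ≠ 0) : octaveCount p ≤ octaveCount (p * q) := by
  by_cases hp : p = 0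
  · subst hp; simp [octaveCount]
  unfold octaveCount
  refine card_le_card (image_subset_image (filter_subset_filter _ (Multiset.toFinset_subset.mpr fun x hx => ?_)))
  exact Multiset.mem_of_le (Polynomial.roots.le_of_dvd (mul_ne_zero hp hq) (dvd_mul_right p q)) hx

/-- **size padding for the octave row**: `OctaveRootLawAt m' K B → OctaveRootLawAt m K B` for `m ≤ m'`, `K ≥ 1` (identity padding on
every class; the extra factor `(∑ₗ X^{dₗ})^{m'−m}` only adds roots). [folklore] -/
theorem octaveRootLawAt_of_le_size {m m' K B : ℕ} (hK : 0 < K) (hm : m ≤ m') (h : OctaveRootLawAt m' K B) :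
    OctaveRootLawAt m K B := by
  obtain ⟨n, rfl⟩ := Nat.exists_eq_add_of_le hm
  intro d S hS
  have h1 := h d (fun l => Matrix.reindex finSumFinEquiv finSumFinEquiv
      (Matrix.fromBlocks (S l) 0 0 (1 : Matrix (Fin n) (Fin n) ℝ))) (fun l => Census.isSymm_padOne (hS l))
  rw [Census.det_pencil_padOne] at h1
  exact (octaveCount_le_of_mul _ _ (pow_ne_zero _ (Census.sum_X_pow_ne_zero hK d))).trans h1

/-- the empty format: with no slope class the pencil is `0` and has no nonzero root octaves. [folklore] -/
theorem octaveRootLawAt_zero_classes (m B : ℕ) : OctaveRootLawAt m 0 B := by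
  intro d S hS
  have h0 : (∑ l : Fin 0, ((Polynomial.X : Polynomial ℝ) ^ d l) • (S l).map Polynomial.C) = 0 := by simp
  rw [h0]
  rcases Nat.eq_zero_or_pos m with rfl | hm
  · have : octaveCount (Matrix.det (0 : Matrix (Fin 0) (Fin 0) ℝ[X])) = 0 := by
      simp [octaveCount, Matrix.det_isEmpty]
    omega
  · haveI : Nonempty (Fin m) := ⟨⟨0, hm⟩⟩
    rw [Matrix.det_zero]
    simp [octaveCount]

/-! ## 4. The composition: `TropicalB → OctaveFatLifting → OctaveWeakLifting` -/

/-- **COMPOSITION (kernel-checked, sorry-free).**  The route item `TropicalB` (stmt-19771) enters BY NAME; the fat law `OctaveFatLifting` is the only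
other hypothesis.  Constant: `C = C_F + 2·C_T + 1`. -/
theorem OctaveWeakLifting_of (hT : TropicalB) (hF : OctaveFatLifting) : OctaveWeakLifting := by
  obtain ⟨CT, hT⟩ := tropicalB_iff.mp hT
  obtain ⟨CF, hF⟩ := hF
  refine ⟨CF + 2 * CT + 1, fun m K n hrow => ?_⟩
  set L := Nat.log 2 m with hL
  by_cases hfat : L ^ 2 ≤ K
  · refine octaveRootLawAt_mono (Nat.mul_le_mul_right (n + 1) (Nat.pow_le_pow_right two_pos ?_)) (hF m K n hfat hrow)
    nlinarith [Nat.zero_le (K + L ^ 2), Nat.zero_le CT]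
  · have hKL : K ≤ L ^ 2 := by omega
    have hL1 : 1 ≤ L ^ 2 := by omega
    have hrow' : SignedRow m (L ^ 2) (2 ^ (CT * (L ^ 2 + L ^ 2))) := hT m (L ^ 2)
    have h1 : OctaveRootLawAt m (L ^ 2) (2 ^ (CF * L ^ 2) * (2 ^ (CT * (L ^ 2 + L ^ 2)) + 1)) := hF m (L ^ 2) _ le_rfl hrow'
    have h2 : OctaveRootLawAt m K (2 ^ (CF * L ^ 2) * (2 ^ (CT * (L ^ 2 + L ^ 2)) + 1)) := octaveRootLawAt_of_le_classes hKL h1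
    refine octaveRootLawAt_mono ?_ h2
    have h3 : 2 ^ (CT * (L ^ 2 + L ^ 2)) + 1 ≤ 2 ^ (CT * (L ^ 2 + L ^ 2) + 1) := by
      have h := Nat.one_le_two_pow (n := CT * (L ^ 2 + L ^ 2))
      have h' : 2 ^ (CT * (L ^ 2 + L ^ 2) + 1) = 2 ^ (CT * (L ^ 2 + L ^ 2)) * 2 := Nat.pow_succ 2 _
      omega
    have h4 : CF * L ^ 2 + (CT * (L ^ 2 + L ^ 2) + 1) ≤ (CF + 2 * CT + 1) * (K + L ^ 2) := by nlinarith
    calc 2 ^ (CF * L ^ 2) * (2 ^ (CT * (L ^ 2 + L ^ 2)) + 1)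
        ≤ 2 ^ (CF * L ^ 2) * 2 ^ (CT * (L ^ 2 + L ^ 2) + 1) := Nat.mul_le_mul_left _ h3
      _ = 2 ^ (CF * L ^ 2 + (CT * (L ^ 2 + L ^ 2) + 1)) := (pow_add 2 _ _).symm
      _ ≤ 2 ^ ((CF + 2 * CT + 1) * (K + L ^ 2)) := Nat.pow_le_pow_right two_pos h4
      _ ≤ 2 ^ ((CF + 2 * CT + 1) * (K + L ^ 2)) * (n + 1) := Nat.le_mul_of_pos_right _ (Nat.succ_pos n)

/-! ## 5. Honesty: where the transfer and the rung sit -/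

/-- Ω-W ⇒ the fat law (trivial direction: `2^(C(K+L²)) ≤ 2^(2C·K)` on fat formats). -/
theorem octaveFatLifting_of_octaveWeakLifting (h : OctaveWeakLifting) : OctaveFatLifting := by
  obtain ⟨C, hC⟩ := octaveWeakLifting_iff.mp h
  refine ⟨2 * C, fun m K n hfat hrow => octaveRootLawAt_mono (Nat.mul_le_mul_right (n + 1) (Nat.pow_le_pow_right two_pos ?_)) (hC m K n hrow)⟩
  nlinarith

/-- **REGIME COLLAPSE MODULO THE SIBLING CRUX**: given `TropicalB`, Ω-W is equivalent to its fat regime. -/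
theorem octaveFatLifting_iff_octaveWeakLifting_of_tropicalB (hT : TropicalB) : OctaveFatLifting ↔ OctaveWeakLifting :=
  ⟨fun hF => OctaveWeakLifting_of hT hF, octaveFatLifting_of_octaveWeakLifting⟩

/-- **MODULO `TropicalB` THE OCTAVE LIFTING CRUX IS THE HYPOTHESIS-FREE COUNTING LAW Ω-B** (critic verdict #13): given TB,
`OctaveFatLifting ↔ Ω-B` (→ through Ω-W and the landed glue `octaveKLaw_of_tropicalB_of_octaveWeakLifting`; ← by budget monotonicity).
So `OctaveFatLifting` is NOT a weaker crux or a second door for the route — it is Ω-W (hence Ω-B) in fat-format clothes. -/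
theorem octaveFatLifting_iff_octaveKLaw_of_tropicalB (hT : TropicalB) :
    OctaveFatLifting ↔ ∃ C : ℕ, ∀ m K : ℕ, OctaveRootLawAt m K (2 ^ (C * (K + Nat.log 2 m ^ 2))) :=
  ⟨fun hF => octaveKLaw_of_tropicalB_of_octaveWeakLifting hT (OctaveWeakLifting_of hT hF),
   fun hΩ => octaveFatLifting_of_octaveWeakLifting (OctaveExact.octaveWeakLifting_of_octaveKLaw hΩ)⟩

/-- the same with the NAMED law `Octave.OctaveKLaw` (…OctaveDefs). -/
theorem octaveFatLifting_iff_namedOctaveKLaw_of_tropicalB (hT : TropicalB) : OctaveFatLifting ↔ Octave.OctaveKLaw :=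
  octaveFatLifting_iff_octaveKLaw_of_tropicalB hT

/-- `⌊log₂(A·K)⌋² ≤ K` once `K ≥ 4^(max (⌊log₂A⌋+2) 8)`. [folklore] (same lemma as in `Cruxes/TropicalB/Lines/aspect_decay.lean`) -/
theorem log_sq_mul_le {A K : ℕ} (hK : 4 ^ max (Nat.log 2 A + 2) 8 ≤ K) : Nat.log 2 (A * K) ^ 2 ≤ K := by
  have h0 := PolyTowers.sq_log_succ_le_self (Nat.log 2 A + 2) K hK
  have hlog : Nat.log 2 (A * K) ≤ Nat.log 2 A + Nat.log 2 K + 1 := by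
    rcases Nat.eq_zero_or_pos (A * K) with hz | hpos
    · rw [hz, Nat.log_zero_right]; omega
    have hA : A < 2 ^ (Nat.log 2 A + 1) := Nat.lt_pow_succ_log_self one_lt_two A
    have hK' : K < 2 ^ (Nat.log 2 K + 1) := Nat.lt_pow_succ_log_self one_lt_two K
    have hAK : A * K < 2 ^ (Nat.log 2 A + Nat.log 2 K + 2) := by
      calc A * K < 2 ^ (Nat.log 2 A + 1) * 2 ^ (Nat.log 2 K + 1) := Nat.mul_lt_mul'' hA hK'
        _ = 2 ^ (Nat.log 2 A + Nat.log 2 K + 2) := by rw [← pow_add]; ring_nf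
    have := Nat.log_lt_of_lt_pow hpos.ne' hAK
    omega
  have h1 : Nat.log 2 A + Nat.log 2 K + 1 ≤ (Nat.log 2 A + 2) * (Nat.log 2 K + 1) := by nlinarith
  calc Nat.log 2 (A * K) ^ 2 ≤ (Nat.log 2 A + Nat.log 2 K + 1) ^ 2 := Nat.pow_le_pow_left hlog 2
    _ ≤ ((Nat.log 2 A + 2) * (Nat.log 2 K + 1)) ^ 2 := Nat.pow_le_pow_left h1 2
    _ = (Nat.log 2 A + 2) ^ 2 * (Nat.log 2 K + 1) ^ 2 := by ring
    _ ≤ K := h0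

/-- the rung from the FAT law, onset `K₀(A) = 4^(max (⌊log₂A⌋+2) 8)`: a format `m ≤ A·K` with `K ≥ K₀(A)` is fat. -/
theorem boundedAspectOctaveLifting_of_octaveFatLifting (h : OctaveFatLifting) : BoundedAspectOctaveLifting := by
  obtain ⟨C, hC⟩ := h
  refine ⟨C, fun A => ⟨4 ^ max (Nat.log 2 A + 2) 8, fun m K n hK hm hrow => hC m K n ?_ hrow⟩⟩
  calc Nat.log 2 m ^ 2 ≤ Nat.log 2 (A * K) ^ 2 := Nat.pow_le_pow_left (Nat.log_mono_right hm) 2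
    _ ≤ K := log_sq_mul_le hK

/-- HONESTY: the rung is a CONSEQUENCE of the crux. -/
theorem boundedAspectOctaveLifting_of_octaveWeakLifting (h : OctaveWeakLifting) : BoundedAspectOctaveLifting :=
  boundedAspectOctaveLifting_of_octaveFatLifting (octaveFatLifting_of_octaveWeakLifting h)

/-- KILL PATH: a refutation of the rung refutes the crux (and with it the route `KPlusLogSqLawOctave`). -/
theorem not_octaveWeakLifting_of_not_boundedAspectOctaveLifting (h : ¬ BoundedAspectOctaveLifting) : ¬ OctaveWeakLifting :=
  fun hΩ => h (boundedAspectOctaveLifting_of_octaveWeakLifting hΩ)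

/-! ## 6. Base: the rung at each FIXED aspect is Descartes (inside the known regime — calibration, not content) -/

/-- the octave row is below the real row. [folklore] -/
theorem octaveRootLawAt_of_realRootLawAt {m K B : ℕ} (h : RealRootLawAt m K B) : OctaveRootLawAt m K B :=
  fun d S hS => (octaveCount_le_card _).trans (h d S hS)

/-- **FIXED-ASPECT BASE (Descartes).**  For each dyadic aspect bound `2^c` the rung's inequality holds with a constant
`C_c = 2·(2^c+1)` DEPENDING ON `c` (from `realRootLawAt_fatCone`: `ζ ≤ 2^((2^c+1)(K+L²))`, and `L² ≤ K` past the onset), with no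
tropical input at all — so the rung's whole content is the UNIFORMITY of `C` in the aspect, exactly as for its tropical twin
`BoundedAspectRate` vs `DoublingQuasi.tropRootLawAt_fatCone`. -/
theorem boundedAspectOctaveLifting_fixedAspect (c : ℕ) :
    ∃ C K₀ : ℕ, ∀ m K n : ℕ, K₀ ≤ K → m ≤ 2 ^ c * K → SignedRow m K n → OctaveRootLawAt m K (2 ^ (C * K) * (n + 1)) := by
  refine ⟨2 * (2 ^ c + 1), 4 ^ max (Nat.log 2 (2 ^ c) + 2) 8, fun m K n hK hm _ => ?_⟩
  have hL : Nat.log 2 m ^ 2 ≤ K :=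
    (Nat.pow_le_pow_left (Nat.log_mono_right hm) 2).trans (log_sq_mul_le hK)
  refine octaveRootLawAt_mono ?_ (octaveRootLawAt_of_realRootLawAt (realRootLawAt_fatCone c m K hm))
  calc 2 ^ ((2 ^ c + 1) * (K + Nat.log 2 m ^ 2)) ≤ 2 ^ (2 * (2 ^ c + 1) * K) :=
        Nat.pow_le_pow_right two_pos (by nlinarith [Nat.zero_le (2 ^ c)])
    _ ≤ 2 ^ (2 * (2 ^ c + 1) * K) * (n + 1) := Nat.le_mul_of_pos_right _ (Nat.succ_pos n)

/-! ## 7. The octave route is a FAT-REGIME pair -/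

/-- the octave route's `TropicalB` is the `KPlusLogSqLaw` route's `TropicalB` (same body; δ). -/
theorem tropicalB_iff_tropicalB' :
    TropicalB ↔ Summit.ValiantsHypothesis.ValiantsHypothesis.Theses.KPlusLogSqLaw.TropicalB := Iff.rfl

/-- **Ω-B ↔ TB-fat ∧ Ω-W-fat**: with `OctaveExact.octaveKLaw_iff` (Ω-B ↔ TB ∧ Ω-W), the tropical regime collapse
`fatStub_iff_tropicalB` and §4–5 here, the hypothesis-free octave law — equivalently the whole route `KPlusLogSqLawOctave` — is
EQUIVALENT to the pair of FAT-regime statements (`⌊log₂m⌋² ≤ K`, budgets `2^(C·K)`): the thin regime carries no independent content. -/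
theorem octaveKLaw_iff_fatPair :
    (∃ C : ℕ, ∀ m K : ℕ, OctaveRootLawAt m K (2 ^ (C * (K + Nat.log 2 m ^ 2)))) ↔
    ((∃ C : ℕ, ∀ m K : ℕ, Nat.log 2 m ^ 2 ≤ K → TropRootLawAt m K (2 ^ (C * K))) ∧ OctaveFatLifting) := by
  rw [OctaveExact.octaveKLaw_iff]
  constructor
  · rintro ⟨hT, hΩ⟩
    exact ⟨fatStub_iff_tropicalB.mpr (tropicalB_iff_tropicalB'.mp hT), octaveFatLifting_of_octaveWeakLifting hΩ⟩
  · rintro ⟨hfat, hF⟩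
    have hT : TropicalB := tropicalB_iff_tropicalB'.mpr (fatStub_iff_tropicalB.mp hfat)
    exact ⟨hT, OctaveWeakLifting_of hT hF⟩

/-- hence, unconditionally: a refutation of EITHER fat statement refutes Ω-B (and the route). -/
theorem not_octaveKLaw_of_not_octaveFatLifting (h : ¬ OctaveFatLifting) :
    ¬ (∃ C : ℕ, ∀ m K : ℕ, OctaveRootLawAt m K (2 ^ (C * (K + Nat.log 2 m ^ 2)))) :=
  fun hΩ => h (octaveKLaw_iff_fatPair.mp hΩ).2

/-- the named hypothesis-free octave law `Octave.OctaveKLaw` (…OctaveDefs) is the glue-currency one (δ). -/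
theorem octaveKLaw_iff_glue : Octave.OctaveKLaw ↔ ∃ C : ℕ, ∀ m K : ℕ, OctaveRootLawAt m K (2 ^ (C * (K + Nat.log 2 m ^ 2))) :=
  Iff.rfl

/-- arithmetic of the diagonal localisation: with `s = max (√K+1) (L+1)`, `s² ≤ 2K + 2L² + 4`. -/
theorem diag_budget (K L : ℕ) : (max (Nat.sqrt K + 1) (L + 1)) ^ 2 ≤ 2 * K + 2 * L ^ 2 + 4 := by
  have h1 : (Nat.sqrt K + 1) ^ 2 ≤ 2 * K + 2 := by
    have hs : Nat.sqrt K ^ 2 ≤ K := Nat.sqrt_le' K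
    have h2 : Nat.sqrt K ≤ K := Nat.sqrt_le_self K
    nlinarith
  have h3 : (L + 1) ^ 2 ≤ 2 * L ^ 2 + 2 := by nlinarith
  rcases le_total (Nat.sqrt K + 1) (L + 1) with h | h
  · rw [max_eq_right h]; omega
  · rw [max_eq_left h]; omega

/-- **DIAGONAL LOCALISATION of Ω-B** (octave twin of `kPlusLogSqLaw_iff_diagonal`): by size padding and class padding the
hypothesis-free octave law is equivalent to its restriction to the single format sequence `(2^s, s²)` with budget `2^(C·s²)`. -/
theorem octaveKLaw_iff_diagonal :
    (∃ C : ℕ, ∀ m K : ℕ, OctaveRootLawAt m K (2 ^ (C * (K + Nat.log 2 m ^ 2)))) ↔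
    (∃ C : ℕ, ∀ s : ℕ, OctaveRootLawAt (2 ^ s) (s ^ 2) (2 ^ (C * s ^ 2))) := by
  constructor
  · rintro ⟨C, hC⟩
    refine ⟨2 * C, fun s => ?_⟩
    have h := hC (2 ^ s) (s ^ 2)
    rw [Nat.log_pow one_lt_two] at h
    refine octaveRootLawAt_mono (Nat.pow_le_pow_right two_pos ?_) h
    nlinarith
  · rintro ⟨C, hC⟩
    refine ⟨8 * C, fun m K => ?_⟩
    rcases Nat.eq_zero_or_pos K with rfl | hK
    · exact octaveRootLawAt_zero_classes m _
    set L := Nat.log 2 m with hL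
    set s := max (Nat.sqrt K + 1) (L + 1) with hs
    have hKs : K ≤ s ^ 2 := by
      have : K < (Nat.sqrt K + 1) ^ 2 := Nat.lt_succ_sqrt' K
      have : (Nat.sqrt K + 1) ^ 2 ≤ s ^ 2 := Nat.pow_le_pow_left (le_max_left _ _) 2
      omega
    have hms : m ≤ 2 ^ s := by
      have : m < 2 ^ (L + 1) := Nat.lt_pow_succ_log_self one_lt_two m
      have : 2 ^ (L + 1) ≤ 2 ^ s := Nat.pow_le_pow_right two_pos (le_max_right _ _)
      omega
    have hs0 : 0 < s ^ 2 := by positivity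
    have h1 : OctaveRootLawAt m (s ^ 2) (2 ^ (C * s ^ 2)) := octaveRootLawAt_of_le_size hs0 hms (hC s)
    have h2 : OctaveRootLawAt m K (2 ^ (C * s ^ 2)) := octaveRootLawAt_of_le_classes hKs h1
    refine octaveRootLawAt_mono (Nat.pow_le_pow_right two_pos ?_) h2
    have hb := diag_budget K L
    rw [← hs] at hb
    have : s ^ 2 ≤ 8 * (K + L ^ 2) := by omega
    calc C * s ^ 2 ≤ C * (8 * (K + L ^ 2)) := Nat.mul_le_mul_left C this
      _ = 8 * C * (K + L ^ 2) := by ring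

/-- the NAMED law localised: `Octave.OctaveKLaw ↔ ∃ C, ∀ s, Ω-row(2^s, s²) ≤ 2^(C s²)`. -/
theorem namedOctaveKLaw_iff_diagonal :
    Octave.OctaveKLaw ↔ ∃ C : ℕ, ∀ s : ℕ, OctaveRootLawAt (2 ^ s) (s ^ 2) (2 ^ (C * s ^ 2)) :=
  octaveKLaw_iff_glue.trans octaveKLaw_iff_diagonal

/-- the NAMED law is the route: `Octave.OctaveKLaw ↔ TropicalB ∧ OctaveWeakLifting` (`OctaveExact.octaveKLaw_iff`, δ). -/
theorem namedOctaveKLaw_iff_route : Octave.OctaveKLaw ↔ (TropicalB ∧ OctaveWeakLifting) :=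
  octaveKLaw_iff_glue.trans OctaveExact.octaveKLaw_iff

end Summit.ValiantsHypothesis.ValiantsHypothesis.Theorems.KPlusLogSqLaw.OctaveFatLocation
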